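import Summits.CriticalPhenomena.CardyFormulaZ2.Theses.CardyIKTransport
import Literature.Probability.Percolation.QuadCrossingSquareModel
import Literature.Probability.Percolation.PlanarDuality
import Literature.Probability.LatticeModels.IsoradialGraphsProofs
import Literature.Topology.PlaneTopology.PlusCrossing

/-!
# `RenewalGridHarmless` (stmt-CriticalPhenomena-4967), sandwich step 2: a crude crossing of `R`
# and a dual-open chain across the conjugate bulged template cannot coexist

Route `CardyIKTransport`, support item `RenewalGridHarmless`. Deterministic geometry for the
`limsup` half of the sandwich (no probability here).

Setting: `R` a conformal rectangle with square model `Φ : ℂ ≃ₜ ℂ`. A crude crossing of `R` at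
mesh `δ` (`embDomainCrossing squareLatticeEmbedding.z`: an open lattice chain, all vertices
`δ√2 (v₀ + i v₁)` in `R.carrier`, from within `2δ` of `R.arc 0 = Φ`(bottom) to within `2δ` of
`R.arc 2 = Φ`(top)), drawn as a polygonal curve `V`, pulls back under `Φ` into the vertical strip
`|re| ≤ 1 + ν` and joins heights `≤ -1 + ν` and `≥ 1 - ν`. A DUAL chain `w 0, …, w m` of
dual-open edges (`dualConfig`), whose true positions `δ · squareLatticeEmbedding.c (w j)` (face
centres) are within `ρ/2` of "hypothesis positions" lying in the closed CONJUGATE template (chart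
`re ∈ [-1-ε, 1+ε]`, `im ∈ [-1+ε, 1-ε]`) and starting/ending within `ρ/2` of its far sides
`re = ±(1+ε)`, drawn as `H`, pulls back into the horizontal band `|im| ≤ 1 - ε + 2ν` and joins
`{re ≥ 1 + ν}` to `{re ≤ -1 - ν}`. By the plus-position lemma through the chart
(`inter_nonempty_of_plus_chart`) `V ∩ H ≠ ∅`; a common point lies on a primal edge segment and a
dual edge segment, which forces the dual edge to be the dual of the primal one
(`dualEdge_eq_of_mem_segment_inter`) — impossible, an open edge has a closed dual
(`main theorem: false_of_crossing_of_dualChain`).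

Also here: extraction of vertex chains from `openConnIn` (`exists_chain_of_mem_openConnIn`) and
the polygonal curve of a chain (`{P 0} ∪ ⋃ k < n, [P k, P (k+1)]`: compact, preconnected).

References: B. Bollobás, O. Riordan, *Percolation* (2006), Ch. 3 Lemma 1 (duality), Ch. 7
Claim 19 (crossing continua meet); G. Grimmett, *Percolation* (1999) §11.2; the tree's
`PlanarDuality.lean` (`dualEdge`, `dualConfig`), `PlusCrossing.lean`.
-/

noncomputable section

namespace Summit.CriticalPhenomena.CardyFormulaZ2.Theorems.CardyIKTransport.RenewalGridHarmless

open Filter Set Metric MeasureTheory Complex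
open scoped Topology
open Literature.Probability.Percolation
open Literature.Probability.LatticeModels
open Literature.Probability.RandomPlanarGeometry
open Literature.Topology.PlaneTopology

/-! ### Vertex chains of restricted open connections -/

/-- **Chain extraction.** `{x ↔ y in S}` is witnessed by a finite chain of vertices of `S` with
consecutive OPEN edges (distinct endpoints), `v 0 = x`, `v n = y`. [folklore] -/
theorem exists_chain_of_mem_openConnIn {V : Type*} {ω : BondConfig V} {S : Set V} {x y : V}
    (h : ω ∈ openConnIn S x y) :
    ∃ (n : ℕ) (v : ℕ → V), v 0 = x ∧ v n = y ∧ (∀ k, v k ∈ S) ∧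
      ∀ k, k < n → s(v k, v (k + 1)) ∈ ω ∧ v k ≠ v (k + 1) := by
  obtain ⟨hx, hy, ⟨q⟩⟩ := h
  set p : (openGraph ω).Walk x y :=
    (q.map (SimpleGraph.Embedding.induce S).toHom).copy rfl rfl with hp
  have hsupp : ∀ z ∈ p.support, z ∈ S := by
    intro z hz
    rw [hp, SimpleGraph.Walk.support_copy, SimpleGraph.Walk.support_map] at hz
    obtain ⟨w, -, rfl⟩ := List.mem_map.1 hz
    exact w.2
  refine ⟨p.length, fun k => p.getVert k, p.getVert_zero, p.getVert_length,
    fun k => hsupp _ (p.getVert_mem_support k), fun k hk => ?_⟩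
  have := p.adj_getVert_succ hk
  rwa [openGraph_adj] at this

/-! ### Lattice positions: vertices `√2 (v₀ + i v₁)`, face centres `√2 (v + (1+i)/2)` -/

/-- Real part of a scaled vertex position. [folklore] -/
theorem re_mul_z (δ : ℝ) (v : Site 2) :
    ((δ : ℂ) * squareLatticeEmbedding.z v).re = δ * Real.sqrt 2 * (v 0 : ℝ) := by
  rw [squareLatticeEmbedding_z]; simp [Site.toComplex]; ring

/-- Imaginary part of a scaled vertex position. [folklore] -/
theorem im_mul_z (δ : ℝ) (v : Site 2) :
    ((δ : ℂ) * squareLatticeEmbedding.z v).im = δ * Real.sqrt 2 * (v 1 : ℝ) := by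
  rw [squareLatticeEmbedding_z]; simp [Site.toComplex]; ring

/-- Real part of a scaled face-centre (dual vertex) position. [folklore] -/
theorem re_mul_c (δ : ℝ) (v : Site 2) :
    ((δ : ℂ) * squareLatticeEmbedding.c v).re = δ * Real.sqrt 2 * ((v 0 : ℝ) + 1 / 2) := by
  rw [squareLatticeEmbedding_c]; simp [Site.toComplex]; ring

/-- Imaginary part of a scaled face-centre (dual vertex) position. [folklore] -/
theorem im_mul_c (δ : ℝ) (v : Site 2) :
    ((δ : ℂ) * squareLatticeEmbedding.c v).im = δ * Real.sqrt 2 * ((v 1 : ℝ) + 1 / 2) := by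
  rw [squareLatticeEmbedding_c]; simp [Site.toComplex]; ring

/-- Adjacent lattice vertices sit at distance `δ√2` at mesh `δ`. [folklore] -/
theorem dist_mul_z_of_adj {δ : ℝ} (hδ : 0 ≤ δ) {v v' : Site 2} (h : (zdGraph 2).Adj v v') :
    dist ((δ : ℂ) * squareLatticeEmbedding.z v) ((δ : ℂ) * squareLatticeEmbedding.z v') =
      δ * Real.sqrt 2 := by
  rw [dist_eq_norm, ← mul_sub, norm_mul, Complex.norm_real, Real.norm_eq_abs, abs_of_nonneg hδ,
    squareLatticeEmbedding_z, squareLatticeEmbedding_z, ← mul_sub, norm_mul, Complex.norm_real,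
    Real.norm_eq_abs, abs_of_nonneg (Real.sqrt_nonneg 2)]
  congr 1
  have key : ‖Site.toComplex v - Site.toComplex v'‖ = 1 := by
    have hsq : ‖Site.toComplex v - Site.toComplex v'‖ ^ 2 = 1 := by
      rw [Complex.sq_norm, Complex.normSq_apply]
      simp only [Complex.sub_re, Complex.sub_im, Site.toComplex_re, Site.toComplex_im]
      rcases (zdGraph_two_adj_iff v v').1 h with ⟨h0, h1⟩ | ⟨h0, h1⟩ | ⟨h1, h0⟩ | ⟨h1, h0⟩ <;>
        · rw [h0, h1]; push_cast; ring
    nlinarith [norm_nonneg (Site.toComplex v - Site.toComplex v')]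
  rw [key, mul_one]

/-- Adjacent dual vertices (face centres) sit at distance `δ√2` at mesh `δ`. [folklore] -/
theorem dist_mul_c_of_adj {δ : ℝ} (hδ : 0 ≤ δ) {v v' : Site 2} (h : (zdGraph 2).Adj v v') :
    dist ((δ : ℂ) * squareLatticeEmbedding.c v) ((δ : ℂ) * squareLatticeEmbedding.c v') =
      δ * Real.sqrt 2 := by
  have e : ∀ u : Site 2, (δ : ℂ) * squareLatticeEmbedding.c u =
      (δ : ℂ) * squareLatticeEmbedding.z u + (δ : ℂ) * (Real.sqrt 2 * ((1 + I) / 2)) := by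
    intro u; rw [squareLatticeEmbedding_c, squareLatticeEmbedding_z]; ring
  rw [e, e, dist_add_right]
  exact dist_mul_z_of_adj hδ h

/-! ### A primal edge segment meets a dual edge segment only across its own dual edge -/

/-- No integer is a half-integer. [folklore] -/
theorem int_cast_ne_add_half (a b : ℤ) : (a : ℝ) ≠ (b : ℝ) + 1 / 2 := by
  intro h
  have h2 : (2 * a : ℤ) = 2 * b + 1 := by exact_mod_cast (by linarith : (2 * a : ℝ) = 2 * b + 1)
  omega

/-- An integer within `[b + ½ - 1, b + ½]`… precisely: `a ≤ b + ½ ≤ a + 1` forces `b = a`. [folklore] -/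
theorem int_eq_of_half_mem {a b : ℤ} (h1 : (a : ℝ) ≤ (b : ℝ) + 1 / 2) (h2 : (b : ℝ) + 1 / 2 ≤ (a : ℝ) + 1) :
    b = a := by
  have h3 : a < b + 1 := by exact_mod_cast (by linarith : (a : ℝ) < b + 1)
  have h4 : b < a + 1 := by exact_mod_cast (by linarith : (b : ℝ) < a + 1)
  omega

/-- **Primal/dual segment crossing.** If the closed segment joining the positions of two adjacent
lattice vertices `v, v'` (mesh `δ > 0`) meets the closed segment joining the face centres of two
adjacent dual vertices `w, w'`, then `{w, w'}` is the dual edge of `{v, v'}` (`dualEdge`, lower-left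
corner labelling of faces: the dual of the horizontal edge `{x, x+e₀}` is `{x-e₁, x}`, of the
vertical edge `{x, x+e₁}` is `{x-e₀, x}`). [folklore] -/
theorem dualEdge_eq_of_mem_segment_inter {δ : ℝ} (hδ : 0 < δ) {v v' w w' : Site 2}
    (hv : (zdGraph 2).Adj v v') (hw : (zdGraph 2).Adj w w') {z : ℂ}
    (hzv : z ∈ segment ℝ ((δ : ℂ) * squareLatticeEmbedding.z v) ((δ : ℂ) * squareLatticeEmbedding.z v'))
    (hzw : z ∈ segment ℝ ((δ : ℂ) * squareLatticeEmbedding.c w) ((δ : ℂ) * squareLatticeEmbedding.c w')) :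
    dualEdge s(v, v') = s(w, w') := by
  have hL : 0 < δ * Real.sqrt 2 := mul_pos hδ (Real.sqrt_pos.2 (by norm_num))
  -- normalise orientations: `v' = v + eᵢ`, `w' = w + eⱼ`
  wlog hvup : v' 0 = v 0 + 1 ∧ v' 1 = v 1 ∨ v' 1 = v 1 + 1 ∧ v' 0 = v 0 generalizing v v'
  · have hv' : v 0 = v' 0 + 1 ∧ v 1 = v' 1 ∨ v 1 = v' 1 + 1 ∧ v 0 = v' 0 := by
      rcases (zdGraph_two_adj_iff v v').1 hv with h | ⟨h0, h1⟩ | h | ⟨h1, h0⟩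
      · exact absurd (Or.inl h) hvup
      · exact Or.inl ⟨h0, h1.symm⟩
      · exact absurd (Or.inr h) hvup
      · exact Or.inr ⟨h1, h0.symm⟩
    rw [Sym2.eq_swap]
    exact this hv.symm (by rw [segment_symm]; exact hzv) hv'
  wlog hwup : w' 0 = w 0 + 1 ∧ w' 1 = w 1 ∨ w' 1 = w 1 + 1 ∧ w' 0 = w 0 generalizing w w'
  · have hw' : w 0 = w' 0 + 1 ∧ w 1 = w' 1 ∨ w 1 = w' 1 + 1 ∧ w 0 = w' 0 := by
      rcases (zdGraph_two_adj_iff w w').1 hw with h | ⟨h0, h1⟩ | h | ⟨h1, h0⟩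
      · exact absurd (Or.inl h) hwup
      · exact Or.inl ⟨h0, h1.symm⟩
      · exact absurd (Or.inr h) hwup
      · exact Or.inr ⟨h1, h0.symm⟩
    conv_rhs => rw [Sym2.eq_swap]
    exact this hw.symm (by rw [segment_symm]; exact hzw) hw'
  -- coordinates of the four endpoints
  have rv := re_mul_z δ v; have iv := im_mul_z δ v
  have rv' := re_mul_z δ v'; have iv' := im_mul_z δ v'
  have rw_ := re_mul_c δ w; have iw := im_mul_c δ w
  have rw' := re_mul_c δ w'; have iw' := im_mul_c δ w'
  rcases hvup with ⟨hv0, hv1⟩ | ⟨hv1, hv0⟩ <;> rcases hwup with ⟨hw0, hw1⟩ | ⟨hw1, hw0⟩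
  · -- horizontal primal, horizontal dual: distinct heights
    exfalso
    have h1 := ((mem_segment_iff_of_im_eq (by rw [rv, rv', hv0]; push_cast; nlinarith)
      (by rw [iv, iv', hv1])).1 hzv).1
    have h2 := ((mem_segment_iff_of_im_eq (by rw [rw_, rw', hw0]; push_cast; nlinarith)
      (by rw [iw, iw', hw1])).1 hzw).1
    rw [h1, iv, iw] at h2
    have : (v 1 : ℝ) = (w 1 : ℝ) + 1 / 2 := by
      have := mul_left_cancel₀ hL.ne' h2; linarith
    exact int_cast_ne_add_half _ _ this
  · -- horizontal primal `{v, v+e₀}`, vertical dual `{w, w+e₁}`: `w = v - e₁`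
    obtain ⟨hzi, hzr⟩ := (mem_segment_iff_of_im_eq (by rw [rv, rv', hv0]; push_cast; nlinarith)
      (by rw [iv, iv', hv1])).1 hzv
    obtain ⟨hzr', hzi'⟩ := (mem_segment_iff_of_re_eq (by rw [iw, iw', hw1]; push_cast; nlinarith)
      (by rw [rw_, rw', hw0])).1 hzw
    rw [rv, rv', hv0] at hzr; rw [iv] at hzi; rw [rw_] at hzr'; rw [iw, iw', hw1] at hzi'
    push_cast at hzr hzi'
    rw [hzr'] at hzr; rw [hzi] at hzi'
    obtain ⟨ha, hb⟩ := hzr; obtain ⟨hc, hd⟩ := hzi'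
    have e0 : w 0 = v 0 := int_eq_of_half_mem (le_of_mul_le_mul_left (by linarith) hL)
      (le_of_mul_le_mul_left (by linarith) hL)
    have e1 : w 1 = v 1 - 1 := by
      have := int_eq_of_half_mem (a := w 1) (b := v 1 - 1) (by push_cast; nlinarith)
        (by push_cast; nlinarith)
      omega
    have hvv : v' = v + Pi.single 0 1 := by
      rw [Site.eq_iff_two]; simp [hv0, hv1]
    have hww : w = v - Pi.single 1 1 ∧ w' = v := by
      refine ⟨?_, ?_⟩ <;> rw [Site.eq_iff_two]
      · simp [e0, e1]
      · simp [hw0, hw1, e0, e1]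
    rw [hvv, hww.1, hww.2, dualEdge_horizontal]
  · -- vertical primal `{v, v+e₁}`, horizontal dual `{w, w+e₀}`: `w = v - e₀`
    obtain ⟨hzr, hzi⟩ := (mem_segment_iff_of_re_eq (by rw [iv, iv', hv1]; push_cast; nlinarith)
      (by rw [rv, rv', hv0])).1 hzv
    obtain ⟨hzi', hzr'⟩ := (mem_segment_iff_of_im_eq (by rw [rw_, rw', hw0]; push_cast; nlinarith)
      (by rw [iw, iw', hw1])).1 hzw
    rw [iv, iv', hv1] at hzi; rw [rv] at hzr; rw [iw] at hzi'; rw [rw_, rw', hw0] at hzr'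
    push_cast at hzi hzr'
    rw [hzi'] at hzi; rw [hzr] at hzr'
    obtain ⟨ha, hb⟩ := hzi; obtain ⟨hc, hd⟩ := hzr'
    have e1 : w 1 = v 1 := int_eq_of_half_mem (le_of_mul_le_mul_left (by linarith) hL)
      (le_of_mul_le_mul_left (by linarith) hL)
    have e0 : w 0 = v 0 - 1 := by
      have := int_eq_of_half_mem (a := w 0) (b := v 0 - 1) (by push_cast; nlinarith)
        (by push_cast; nlinarith)
      omega
    have hvv : v' = v + Pi.single 1 1 := by
      rw [Site.eq_iff_two]; simp [hv0, hv1]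
    have hww : w = v - Pi.single 0 1 ∧ w' = v := by
      refine ⟨?_, ?_⟩ <;> rw [Site.eq_iff_two]
      · simp [e0, e1]
      · simp [hw0, hw1, e0, e1]
    rw [hvv, hww.1, hww.2, dualEdge_vertical]
  · -- vertical primal, vertical dual: distinct abscissae
    exfalso
    have h1 := ((mem_segment_iff_of_re_eq (by rw [iv, iv', hv1]; push_cast; nlinarith)
      (by rw [rv, rv', hv0])).1 hzv).1
    have h2 := ((mem_segment_iff_of_re_eq (by rw [iw, iw', hw1]; push_cast; nlinarith)
      (by rw [rw_, rw', hw0])).1 hzw).1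
    rw [h1, rv, rw_] at h2
    have : (v 0 : ℝ) = (w 0 : ℝ) + 1 / 2 := by
      have := mul_left_cancel₀ hL.ne' h2; linarith
    exact int_cast_ne_add_half _ _ this

/-! ### The polygonal curve of a chain -/

/-- The polygonal curve `{P 0} ∪ ⋃_{k<n} [P k, P (k+1)]` of a chain is compact. [folklore] -/
theorem isCompact_chainCurve (P : ℕ → ℂ) (n : ℕ) :
    IsCompact ({P 0} ∪ ⋃ k ∈ Finset.range n, segment ℝ (P k) (P (k + 1))) := by
  refine isCompact_singleton.union (Finset.isCompact_biUnion _ fun k _ => ?_)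
  rw [segment_eq_image_lineMap]
  exact isCompact_Icc.image AffineMap.lineMap_continuous

/-- The last point `P n` lies on the polygonal curve. [folklore] -/
theorem last_mem_chainCurve (P : ℕ → ℂ) (n : ℕ) :
    P n ∈ ({P 0} ∪ ⋃ k ∈ Finset.range n, segment ℝ (P k) (P (k + 1))) := by
  rcases Nat.eq_zero_or_pos n with rfl | hn
  · exact Or.inl rfl
  · refine Or.inr (mem_iUnion₂.2 ⟨n - 1, Finset.mem_range.2 (by omega), ?_⟩)
    have e : n - 1 + 1 = n := by omega
    rw [e]; exact right_mem_segment ℝ _ _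

/-- The polygonal curve of a chain is preconnected (consecutive segments share endpoints).
[folklore] -/
theorem isPreconnected_chainCurve (P : ℕ → ℂ) (n : ℕ) :
    IsPreconnected ({P 0} ∪ ⋃ k ∈ Finset.range n, segment ℝ (P k) (P (k + 1))) := by
  induction n with
  | zero => simpa using isPreconnected_singleton
  | succ n ih =>
    have e : ({P 0} ∪ ⋃ k ∈ Finset.range (n + 1), segment ℝ (P k) (P (k + 1))) =
        ({P 0} ∪ ⋃ k ∈ Finset.range n, segment ℝ (P k) (P (k + 1))) ∪
          segment ℝ (P n) (P (n + 1)) := by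
      rw [Finset.range_add_one, Finset.set_biUnion_insert]
      ac_rfl
    rw [e]
    exact IsPreconnected.union (P n) (last_mem_chainCurve P n) (left_mem_segment ℝ _ _) ih
      (convex_segment _ _).isPreconnected

/-- Points of the polygonal curve: `P 0`, or on a segment `[P k, P (k+1)]`, `k < n`. [folklore] -/
theorem mem_chainCurve_iff {P : ℕ → ℂ} {n : ℕ} {z : ℂ} :
    z ∈ ({P 0} ∪ ⋃ k ∈ Finset.range n, segment ℝ (P k) (P (k + 1))) ↔
      z = P 0 ∨ ∃ k, k < n ∧ z ∈ segment ℝ (P k) (P (k + 1)) := by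
  simp only [mem_union, mem_singleton_iff, mem_iUnion, Finset.mem_range, exists_prop]

end Summit.CriticalPhenomena.CardyFormulaZ2.Theorems.CardyIKTransport.RenewalGridHarmless

end
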